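import Summits.Ventures.PercRepro.MSCrossWithin

/-!
# The one-directional cross–within inequality: `|A \\ B| + |D(A) ∪ D(B)| ≥ |A| + |B|`

Dossier proofs/MINE1-theoremS.md, Addendum 71 erratum (mine-1, gen 37). For all finite families
`A, B` the one-directional cross differences already suffice:

* **`card_add_card_le_card_diffs_add_card_withinDiffs`**: `|A| + |B| ≤ |A \\ B| + |D(A) ∪ D(B)|`,

a two-line corollary of the two-family Marica–Schönheim theorem of MSTightTwoFamily
(`card_le_card_diffs_add_card_diffs_sdiff_diffs`: `|A \\ B| + |D(A) \ D(B)| ≥ |A|`) and of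
Marica–Schönheim for `B` (`|D(A) ∪ D(B)| = |D(A) \ D(B)| + |D(B)| ≥ |D(A) \ D(B)| + |B|`). The
cross–within inequality of MSCrossWithin (both directions) is the weaker statement
`card_add_card_le_card_crossDiffs_add_card_withinDiffs'`, re-derived here from it.
-/

namespace PercRepro.MSTight

open Finset
open scoped FinsetFamily

variable {α : Type*} [DecidableEq α]

/-- **The one-directional cross–within inequality**: for all finite families `A, B`,
`|A \\ B| + |D(A) ∪ D(B)| ≥ |A| + |B|`. -/
theorem card_add_card_le_card_diffs_add_card_withinDiffs (A B : Finset (Finset α)) :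
    A.card + B.card ≤ (A \\ B).card + (A \\ A ∪ B \\ B).card := by
  have h1 := card_le_card_diffs_add_card_diffs_sdiff_diffs B A
  have h2 := Finset.card_le_card_diffs B
  have h3 : ((A \\ A) \ (B \\ B)).card + (B \\ B).card = (A \\ A ∪ B \\ B).card :=
    card_sdiff_add_card _ _
  omega

/-- The cross–within inequality of `MSCrossWithin`, re-derived from the one-directional form. -/
theorem card_add_card_le_card_crossDiffs_add_card_withinDiffs' (A B : Finset (Finset α)) :
    A.card + B.card ≤ (A \\ B ∪ B \\ A).card + (A \\ A ∪ B \\ B).card :=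
  (card_add_card_le_card_diffs_add_card_withinDiffs A B).trans
    (Nat.add_le_add_right (card_le_card subset_union_left) _)

end PercRepro.MSTight
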